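import Summits.CriticalPhenomena.SAWScalingLimit.Theorems.SAWReversalUpgradeFaithfulOfNoReturnSqueeze
import Summits.CriticalPhenomena.SAWScalingLimit.Theorems.SAWReversalUpgradeAttachmentExistsTrim
import Summits.CriticalPhenomena.SAWScalingLimit.Theorems.SAWReversalUpgradeAttachmentExistsInverse
import Summits.CriticalPhenomena.SAWScalingLimit.Theorems.SAWReversalUpgradeAttachNoReturnOrder
import HarnessLib

/-!
# Route `SAWReversalUpgrade`, support `AttachNoReturn` (stmt-CriticalPhenomena-18057):
# the pieces of the standard attachment (junction points, access segment, exit ray)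

Helper file for the proof of
`Summit.CriticalPhenomena.SAWScalingLimit.Theses.SAWReversalUpgrade.AttachNoReturn`.

We work with the objects of the route's attachment `let`-block as named in
`SAWReversalUpgradeAttachReversalDefs` (`AttachReversal.lastA/firstB/attZ/midSet/pAcc/qEx/sAcc/
rEx/uMid/vMid`), for a chordal uniformizer `φ` of a Dobrushin domain `(D; a, b)`, a squeeze
angle `0 < e ≤ 1/2` and the extended curve `R = P ∘ projIcc` of a FLAT curve `P` in `closure D`
with `P 0, P 1 ∈ D` (the SAW polyline). Under the non-degeneracy `uMid < vMid` of the
`let`-block we establish what the abstract traversal-order lemma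
(`AttachNoReturn.arc_order`, file `…AttachNoReturnArc`) consumes:

* `attZ` is `T' ∘ R` for the patched squeeze `T'` of `FaithfulAttach` — continuous, flat, and
  `κ`-close to `R` when the squeeze is `κ`-close (`attZ_*`);
* the access data: `0 ≤ sAcc ≤ 1`, the access point `Ja = Φ (sAcc · pAcc)` is the value of
  `attZ` at `uMid`, and the access segment meets the middle set only at its end (`sAcc_spec`,
  `uMid_spec`);
* the exit data: when the polyline does not visit `b`, `1 ≤ rEx`, `Jb = Φ (rEx · qEx)` is the
  value of `attZ` at `vMid` and the ray beyond `rEx` misses the middle set; when it does,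
  `vMid = firstB` and `attZ vMid = b` (`vMid_spec_*`).
-/

noncomputable section

open Set Filter Metric Complex Function
open scoped Topology unitInterval
open UpperHalfPlane (upperHalfPlaneSet)
open Literature.Probability.RandomPlanarGeometry

namespace Summit.CriticalPhenomena.SAWScalingLimit.Theorems

namespace AttachNoReturn

open AttachReversal FaithfulAttach

variable {D : DobrushinDomain} {φ : ConformalEquiv upperHalfPlaneSet D.carrier} {e : ℝ}
  {P : C(I, ℂ)} {R : ℝ → ℂ}

/-! ### The marked points and the curve -/

section Curve

variable (hR : ∀ u, R u = P (projIcc 0 1 zero_le_one u))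
  (hPcl : ∀ t, P t ∈ closure D.carrier) (hP0 : P 0 ∈ D.carrier) (hP1 : P 1 ∈ D.carrier)

include hR

/-- `R` is continuous. -/
theorem R_continuous : Continuous R := trim_R_continuous hR

include hPcl in
/-- `R` takes values in `closure D`. -/
theorem R_mem_closure (u : ℝ) : R u ∈ closure D.carrier := trim_R_mem hR hPcl u

include hP0 in
/-- `R 0 = P 0` is neither marked point. -/
theorem R_zero_ne : R 0 ≠ D.pt 0 ∧ R 0 ≠ D.pt 1 := by
  rw [(trim_R_zero_one hR).1]
  exact ⟨fun h => MarkedDomain.pt_notMem_carrier D 0 (h ▸ hP0), fun h => MarkedDomain.pt_notMem_carrier D 1 (h ▸ hP0)⟩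

include hP1 in
/-- `R 1 = P 1` is neither marked point. -/
theorem R_one_ne : R 1 ≠ D.pt 0 ∧ R 1 ≠ D.pt 1 := by
  rw [(trim_R_zero_one hR).2]
  exact ⟨fun h => MarkedDomain.pt_notMem_carrier D 0 (h ▸ hP1), fun h => MarkedDomain.pt_notMem_carrier D 1 (h ▸ hP1)⟩

/-- Flatness of `P` transfers to `R` on `[0, 1]`. -/
theorem R_flat (hflat : ∀ s t : I, P s = P t → ∀ w : I, s ≤ w → w ≤ t → P w = P s)
    {u u' : ℝ} (hu : u ∈ Icc (0 : ℝ) 1) (hu' : u' ∈ Icc (0 : ℝ) 1)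
    (heq : R u = R u') {w : ℝ} (hw : w ∈ Icc u u') : R w = R u := by
  have hw01 : w ∈ Icc (0 : ℝ) 1 := ⟨hu.1.trans hw.1, hw.2.trans hu'.2⟩
  rw [trim_R_of_mem hR hu, trim_R_of_mem hR hu'] at heq
  rw [trim_R_of_mem hR hw01, trim_R_of_mem hR hu]
  exact hflat ⟨u, hu⟩ ⟨u', hu'⟩ heq ⟨w, hw01⟩ (Subtype.mk_le_mk.2 hw.1) (Subtype.mk_le_mk.2 hw.2)

/-! ### The trimming times `i = lastA`, `j = firstB` -/

include hP0 in
/-- `R i ≠ b` and `R i ∈ closure D` (where `i = lastA a R`). -/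
theorem R_lastA_mem (hPcl : ∀ t, P t ∈ closure D.carrier) :
    R (lastA (D.pt 0) R) ∈ closure D.carrier ∧ R (lastA (D.pt 0) R) ≠ D.pt 1 := by
  have hab : D.pt 0 ≠ D.pt 1 := D.pt_injective.ne (by decide)
  have h := trim_R_i_mem (D := D.carrier) hR rfl hab (MarkedDomain.pt_notMem_carrier D 1) hPcl hP0
  exact ⟨h.1, h.2⟩

/-- `R i = a`, or `i = 0` and `a` is never visited. -/
theorem lastA_dichotomy :
    R (lastA (D.pt 0) R) = D.pt 0 ∨
      (lastA (D.pt 0) R = 0 ∧ ∀ u ∈ Icc (0 : ℝ) 1, R u ≠ D.pt 0) :=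
  (trim_i_spec hR rfl).2

/-- `i ∈ [0, 1]`. -/
theorem lastA_mem : lastA (D.pt 0) R ∈ Icc (0 : ℝ) 1 := (trim_i_spec hR rfl).1

/-- `j ∈ [0, 1]`. -/
theorem firstB_mem : firstB (D.pt 1) R ∈ Icc (0 : ℝ) 1 := (trim_j_spec hR rfl).1

/-- `R j = b`, or `j = 1` and `b` is never visited. -/
theorem firstB_dichotomy :
    R (firstB (D.pt 1) R) = D.pt 1 ∨
      (firstB (D.pt 1) R = 1 ∧ ∀ u ∈ Icc (0 : ℝ) 1, R u ≠ D.pt 1) :=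
  (trim_j_spec hR rfl).2

/-- On `[i, j]`, only `j` can be sent to `b` and only `i` to `a`. -/
theorem eq_of_R_eq {u : ℝ} (hu : u ∈ Icc (lastA (D.pt 0) R) (firstB (D.pt 1) R)) :
    (R u = D.pt 1 → u = firstB (D.pt 1) R) ∧ (R u = D.pt 0 → u = lastA (D.pt 0) R) :=
  ⟨trim_eq_j_of_R_eq_b hR rfl rfl hu, trim_eq_i_of_R_eq_a hR rfl rfl hu⟩

/-- `[i, j] ⊆ [0, 1]`. -/
theorem Icc_lastA_firstB_subset :
    Icc (lastA (D.pt 0) R) (firstB (D.pt 1) R) ⊆ Icc (0 : ℝ) 1 := trim_Icc_subset hR rfl rfl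

end Curve

/-! ### The pushed curve `attZ = T' ∘ R` -/

section Pushed

variable (hφ : D.IsChordalUniformizing φ) (he0 : 0 < e) (he1 : e ≤ 1 / 2)
  (hR : ∀ u, R u = P (projIcc 0 1 zero_le_one u))
  (hPcl : ∀ t, P t ∈ closure D.carrier)

/-- `attZ` is the patched squeeze `T'` of `FaithfulAttach` applied to `R` (definitional). -/
theorem attZ_eq (u : ℝ) : attZ (D.pt 1) φ.boundaryExtension e R u =
    @ite ℂ (R u = D.pt 1) (Classical.propDecidable _) (D.pt 1)
      (φ.boundaryExtension (squeeze e (hinv φ.boundaryExtension (R u)))) := rfl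

include hφ he0 he1 hR hPcl

/-- `attZ` is continuous. -/
theorem attZ_continuous : Continuous (attZ (D.pt 1) φ.boundaryExtension e R) :=
  (continuousOn_transport' hφ he0 he1).comp_continuous (R_continuous hR) (R_mem_closure hR hPcl)

/-- `attZ u = attZ u'` forces `R u = R u'`. -/
theorem R_eq_of_attZ_eq {u u' : ℝ} (h : attZ (D.pt 1) φ.boundaryExtension e R u =
    attZ (D.pt 1) φ.boundaryExtension e R u') : R u = R u' :=
  transport'_injOn hφ he0 he1 (R_mem_closure hR hPcl u) (R_mem_closure hR hPcl u') h

/-- `attZ u = b ↔ R u = b`. -/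
theorem attZ_eq_pt_one_iff (u : ℝ) :
    attZ (D.pt 1) φ.boundaryExtension e R u = D.pt 1 ↔ R u = D.pt 1 :=
  transport'_eq_pt_one_iff hφ he0 he1 (R_mem_closure hR hPcl u)

/-- `attZ u = a ↔ R u = a`. -/
theorem attZ_eq_pt_zero_iff (u : ℝ) :
    attZ (D.pt 1) φ.boundaryExtension e R u = D.pt 0 ↔ R u = D.pt 0 :=
  transport'_eq_pt_zero_iff hφ he0 he1 (R_mem_closure hR hPcl u)

omit he0 he1 in
/-- `attZ` is `κ`-close to `R` when the squeeze is `κ`-close to the identity through `Φ`. -/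
theorem dist_attZ_lt {κ : ℝ} (hκ : 0 < κ)
    (hclose : ∀ z : ℂ, 0 ≤ z.im →
      dist (φ.boundaryExtension (squeeze e z)) (φ.boundaryExtension z) < κ) (u : ℝ) :
    dist (attZ (D.pt 1) φ.boundaryExtension e R u) (R u) < κ :=
  dist_transport'_lt hφ hκ hclose (R_mem_closure hR hPcl u)

omit hφ he0 he1 hR hPcl in
/-- Off `b`, `attZ u = Φ (A_e (ψ (R u)))`. -/
theorem attZ_of_ne {u : ℝ} (hu : R u ≠ D.pt 1) : attZ (D.pt 1) φ.boundaryExtension e R u =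
    φ.boundaryExtension (squeeze e (hinv φ.boundaryExtension (R u))) := by
  rw [attZ_eq, if_neg hu]

/-- Flatness of `attZ` on `[0, 1]` from flatness of `P`. -/
theorem attZ_flat (hflat : ∀ s t : I, P s = P t → ∀ w : I, s ≤ w → w ≤ t → P w = P s)
    {u u' : ℝ} (hu : u ∈ Icc (0 : ℝ) 1) (hu' : u' ∈ Icc (0 : ℝ) 1)
    (heq : attZ (D.pt 1) φ.boundaryExtension e R u = attZ (D.pt 1) φ.boundaryExtension e R u')
    {w : ℝ} (hw : w ∈ Icc u u') :
    attZ (D.pt 1) φ.boundaryExtension e R w = attZ (D.pt 1) φ.boundaryExtension e R u := by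
  have hRw : R w = R u :=
    R_flat hR hflat hu hu' (R_eq_of_attZ_eq hφ he0 he1 hR hPcl heq) hw
  rw [attZ_eq, attZ_eq, hRw]

/-- The middle set `midSet = attZ '' [i, j]` is compact. -/
theorem isCompact_midSet : IsCompact (midSet (D.pt 0) (D.pt 1) φ.boundaryExtension e R) :=
  isCompact_Icc.image (attZ_continuous hφ he0 he1 hR hPcl)

variable (hP0 : P 0 ∈ D.carrier) (hP1 : P 1 ∈ D.carrier)
include hP0 hP1

omit hP0 hP1 in
/-- `b ∈ midSet ↔ R j = b` (given `i ≤ j`). -/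
theorem pt_one_mem_midSet_iff (hij : lastA (D.pt 0) R ≤ firstB (D.pt 1) R) :
    D.pt 1 ∈ midSet (D.pt 0) (D.pt 1) φ.boundaryExtension e R ↔ R (firstB (D.pt 1) R) = D.pt 1 := by
  constructor
  · rintro ⟨u, hu, hZ⟩
    have hRu := (attZ_eq_pt_one_iff hφ he0 he1 hR hPcl u).1 hZ
    rwa [(eq_of_R_eq hR hu).1 hRu] at hRu
  · intro h
    exact ⟨_, right_mem_Icc.2 hij, (attZ_eq_pt_one_iff hφ he0 he1 hR hPcl _).2 h⟩

omit hP0 hP1 in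
/-- `a ∈ midSet ↔ R i = a` (given `i ≤ j`). -/
theorem pt_zero_mem_midSet_iff (hij : lastA (D.pt 0) R ≤ firstB (D.pt 1) R) :
    D.pt 0 ∈ midSet (D.pt 0) (D.pt 1) φ.boundaryExtension e R ↔ R (lastA (D.pt 0) R) = D.pt 0 := by
  constructor
  · rintro ⟨u, hu, hZ⟩
    have hRu := (attZ_eq_pt_zero_iff hφ he0 he1 hR hPcl u).1 hZ
    rwa [(eq_of_R_eq hR hu).2 hRu] at hRu
  · intro h
    exact ⟨_, left_mem_Icc.2 hij, (attZ_eq_pt_zero_iff hφ he0 he1 hR hPcl _).2 h⟩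

/-! ### The access data `pAcc`, `sAcc`, `uMid` -/

omit hP1 in
/-- The access direction `p = A_e (ψ (R i))`: in the closed half-plane, of norm `‖ψ (R i)‖`,
zero iff `R i = a`, and `Φ p = attZ i`. -/
theorem pAcc_spec :
    0 ≤ (pAcc (D.pt 0) φ.boundaryExtension e R).im ∧
      ‖pAcc (D.pt 0) φ.boundaryExtension e R‖ = ‖hinv φ.boundaryExtension (R (lastA (D.pt 0) R))‖ ∧
      (pAcc (D.pt 0) φ.boundaryExtension e R = 0 ↔ R (lastA (D.pt 0) R) = D.pt 0) ∧
      φ.boundaryExtension (pAcc (D.pt 0) φ.boundaryExtension e R) =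
        attZ (D.pt 1) φ.boundaryExtension e R (lastA (D.pt 0) R) := by
  obtain ⟨hcl, hne⟩ := R_lastA_mem hR hP0 hPcl
  obtain ⟨him, -⟩ := hinv_spec hφ hcl hne
  refine ⟨sqz_im_nonneg he0 he1 (squeeze_spec e) him, sqz_norm (squeeze_spec e) _, ?_, ?_⟩
  · rw [pAcc, sqz_eq_zero_iff (squeeze_spec e), hinv_eq_zero_iff hφ hcl hne]
  · rw [attZ_of_ne hne]
    rfl

omit hP1 in
/-- **The access crossing.** With `s₁ = sAcc`: `0 ≤ s₁ ≤ 1`, the access point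
`Ja = Φ (s₁ · p)` lies in `midSet`, points `Φ (s · p)` with `0 < s < s₁` do not, and
`s₁ = 0 ↔ p = 0` (`↔ R i = a`, the degenerate access). -/
theorem sAcc_spec (hij : lastA (D.pt 0) R ≤ firstB (D.pt 1) R) :
    0 ≤ sAcc (D.pt 0) (D.pt 1) φ.boundaryExtension e R ∧
      sAcc (D.pt 0) (D.pt 1) φ.boundaryExtension e R ≤ 1 ∧
      φ.boundaryExtension ((sAcc (D.pt 0) (D.pt 1) φ.boundaryExtension e R : ℂ) *
        pAcc (D.pt 0) φ.boundaryExtension e R) ∈ midSet (D.pt 0) (D.pt 1) φ.boundaryExtension e R ∧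
      (∀ s : ℝ, 0 < s → s < sAcc (D.pt 0) (D.pt 1) φ.boundaryExtension e R →
        φ.boundaryExtension ((s : ℂ) * pAcc (D.pt 0) φ.boundaryExtension e R) ∉
          midSet (D.pt 0) (D.pt 1) φ.boundaryExtension e R) ∧
      (sAcc (D.pt 0) (D.pt 1) φ.boundaryExtension e R = 0 ↔
        pAcc (D.pt 0) φ.boundaryExtension e R = 0) := by
  obtain ⟨hpim, -, hp0, hΦp⟩ := pAcc_spec hφ he0 he1 hR hPcl hP0
  set p := pAcc (D.pt 0) φ.boundaryExtension e R with hp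
  have hZi : attZ (D.pt 1) φ.boundaryExtension e R (lastA (D.pt 0) R) ∈
      midSet (D.pt 0) (D.pt 1) φ.boundaryExtension e R := ⟨_, left_mem_Icc.2 hij, rfl⟩
  by_cases hpz : p = 0
  · -- degenerate access: the whole "segment" is the point `a = attZ i ∈ midSet`
    have hall : ∀ s ∈ Ioc (0 : ℝ) 1, φ.boundaryExtension ((s : ℂ) * p) ∈
        midSet (D.pt 0) (D.pt 1) φ.boundaryExtension e R := by
      intro s _
      rw [hpz, mul_zero, hφ.boundaryExtension_zero]
      exact (pt_zero_mem_midSet_iff hφ he0 he1 hR hPcl hij).2 (hp0.1 hpz)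
    have hs0 : sAcc (D.pt 0) (D.pt 1) φ.boundaryExtension e R = 0 := firstEntrance_eq_zero hall
    refine ⟨hs0.ge, by rw [hs0]; exact zero_le_one, ?_, fun s hs hss => ?_, ⟨fun _ => hpz, fun _ => hs0⟩⟩
    · rw [hs0, hpz, mul_zero, hφ.boundaryExtension_zero]
      exact (pt_zero_mem_midSet_iff hφ he0 he1 hR hPcl hij).2 (hp0.1 hpz)
    · rw [hs0] at hss; exact absurd hs (not_lt.2 hss.le)
  · -- genuine access: first entrance of `s ↦ Φ (s p)` into the compact `midSet`
    have hcont : ContinuousOn (fun s : ℝ => φ.boundaryExtension ((s : ℂ) * p)) (Icc (0 : ℝ) 1) :=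
      (ray_continuousOn (continuousOn_boundaryExtension_im_nonneg φ) hpim).mono Icc_subset_Ici_self
    have h1 : φ.boundaryExtension (((1 : ℝ) : ℂ) * p) ∈ midSet (D.pt 0) (D.pt 1) φ.boundaryExtension e R := by
      rw [Complex.ofReal_one, one_mul, hΦp]; exact hZi
    have h0 : φ.boundaryExtension (((0 : ℝ) : ℂ) * p) ∉ midSet (D.pt 0) (D.pt 1) φ.boundaryExtension e R := by
      rw [Complex.ofReal_zero, zero_mul, hφ.boundaryExtension_zero,
        pt_zero_mem_midSet_iff hφ he0 he1 hR hPcl hij]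
      exact fun h => hpz (hp0.2 h)
    obtain ⟨hmem, hin, hout⟩ := firstEntrance_spec hcont
      (isCompact_midSet hφ he0 he1 hR hPcl).isClosed h1 h0 (s₁ := sAcc (D.pt 0) (D.pt 1) φ.boundaryExtension e R) rfl
    exact ⟨hmem.1.le, hmem.2, hin, hout, ⟨fun h => absurd hmem.1 (by rw [h]; exact lt_irrefl 0),
      fun h => absurd h hpz⟩⟩

omit hP1 in
/-- **The first cut time.** `uMid ∈ [i, j]` and `attZ uMid = Ja = Φ (s₁ · p)`. -/
theorem uMid_spec (hij : lastA (D.pt 0) R ≤ firstB (D.pt 1) R) :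
    uMid (D.pt 0) (D.pt 1) φ.boundaryExtension e R ∈ Icc (lastA (D.pt 0) R) (firstB (D.pt 1) R) ∧
      attZ (D.pt 1) φ.boundaryExtension e R (uMid (D.pt 0) (D.pt 1) φ.boundaryExtension e R) =
        φ.boundaryExtension ((sAcc (D.pt 0) (D.pt 1) φ.boundaryExtension e R : ℂ) *
          pAcc (D.pt 0) φ.boundaryExtension e R) := by
  obtain ⟨-, -, hin, -⟩ := sAcc_spec hφ he0 he1 hR hPcl hP0 hij
  obtain ⟨u, hu, hZu⟩ := hin
  have h := firstHit_spec ((attZ_continuous hφ he0 he1 hR hPcl).continuousOn) ⟨u, hu, hZu⟩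
    (u₁ := uMid (D.pt 0) (D.pt 1) φ.boundaryExtension e R) rfl
  exact ⟨h.1, h.2.1⟩

/-! ### The exit data `qEx`, `rEx`, `vMid` -/

omit hP0 hP1 in
/-- **Exit data when the polyline visits `b`**: `vMid = j` and `attZ vMid = b`. -/
theorem vMid_spec_of_eq (hij : lastA (D.pt 0) R ≤ firstB (D.pt 1) R)
    (hjb : R (firstB (D.pt 1) R) = D.pt 1) :
    vMid (D.pt 0) (D.pt 1) φ.boundaryExtension e R = firstB (D.pt 1) R ∧
      attZ (D.pt 1) φ.boundaryExtension e R (vMid (D.pt 0) (D.pt 1) φ.boundaryExtension e R) = D.pt 1 := by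
  have hv : vMid (D.pt 0) (D.pt 1) φ.boundaryExtension e R = firstB (D.pt 1) R := by
    have hset : ({u | u ∈ Icc (lastA (D.pt 0) R) (firstB (D.pt 1) R) ∧ R (firstB (D.pt 1) R) = D.pt 1 ∧
        u = firstB (D.pt 1) R} ∪ {u | u ∈ Icc (lastA (D.pt 0) R) (firstB (D.pt 1) R) ∧
        R (firstB (D.pt 1) R) ≠ D.pt 1 ∧ attZ (D.pt 1) φ.boundaryExtension e R u =
          φ.boundaryExtension ((rEx (D.pt 0) (D.pt 1) φ.boundaryExtension e R : ℂ) *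
            qEx (D.pt 1) φ.boundaryExtension e R)}) = {firstB (D.pt 1) R} := by
      ext u
      simp only [mem_union, mem_setOf_eq, mem_singleton_iff, hjb, ne_eq, not_true_eq_false,
        false_and, and_false, or_false, true_and]
      exact ⟨fun h => h.2, fun h => ⟨by rw [h]; exact right_mem_Icc.2 hij, h⟩⟩
    rw [vMid, hset, csSup_singleton]
  refine ⟨hv, ?_⟩
  rw [hv]
  exact (attZ_eq_pt_one_iff hφ he0 he1 hR hPcl _).2 hjb

omit hP0 in
/-- The exit direction `q = A_e (ψ (R j))` when `R j ≠ b` (then `j = 1`, `R j = P 1 ∈ D`):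
in the closed half-plane, nonzero, of norm `‖ψ (P 1)‖`, with `Φ q = attZ j`. -/
theorem qEx_spec (hjb : R (firstB (D.pt 1) R) ≠ D.pt 1) :
    0 ≤ (qEx (D.pt 1) φ.boundaryExtension e R).im ∧ qEx (D.pt 1) φ.boundaryExtension e R ≠ 0 ∧
      ‖qEx (D.pt 1) φ.boundaryExtension e R‖ = ‖hinv φ.boundaryExtension (P 1)‖ ∧
      φ.boundaryExtension (qEx (D.pt 1) φ.boundaryExtension e R) =
        attZ (D.pt 1) φ.boundaryExtension e R (firstB (D.pt 1) R) := by
  have hj1 : firstB (D.pt 1) R = 1 := by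
    rcases firstB_dichotomy hR with h | ⟨h, -⟩
    · exact absurd h hjb
    · exact h
  have hRj : R (firstB (D.pt 1) R) = P 1 := by rw [hj1, (trim_R_zero_one hR).2]
  have hcl : R (firstB (D.pt 1) R) ∈ closure D.carrier := R_mem_closure hR hPcl _
  obtain ⟨him, -⟩ := hinv_spec hφ hcl hjb
  refine ⟨sqz_im_nonneg he0 he1 (squeeze_spec e) him, ?_, ?_, ?_⟩
  · rw [qEx, Ne, sqz_eq_zero_iff (squeeze_spec e), hinv_eq_zero_iff hφ hcl hjb, hRj]
    exact (R_one_ne hR hP1).1 ∘ fun h => by rw [(trim_R_zero_one hR).2]; exact h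
  · rw [qEx, sqz_norm (squeeze_spec e), hRj]
  · rw [attZ_of_ne hjb]
    rfl

omit hP0 in
/-- **Exit data when the polyline does not visit `b`.** With `r₁ = rEx`, `q = qEx`:
`1 ≤ r₁`, the exit point `Jb = Φ (r₁ · q)` lies in `midSet`, the ray beyond misses it,
`vMid ∈ [i, j]` and `attZ vMid = Jb`. -/
theorem vMid_spec_of_ne (hij : lastA (D.pt 0) R ≤ firstB (D.pt 1) R)
    (hjb : R (firstB (D.pt 1) R) ≠ D.pt 1) :
    1 ≤ rEx (D.pt 0) (D.pt 1) φ.boundaryExtension e R ∧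
      φ.boundaryExtension ((rEx (D.pt 0) (D.pt 1) φ.boundaryExtension e R : ℂ) *
        qEx (D.pt 1) φ.boundaryExtension e R) ∈ midSet (D.pt 0) (D.pt 1) φ.boundaryExtension e R ∧
      (∀ r : ℝ, rEx (D.pt 0) (D.pt 1) φ.boundaryExtension e R < r →
        φ.boundaryExtension ((r : ℂ) * qEx (D.pt 1) φ.boundaryExtension e R) ∉
          midSet (D.pt 0) (D.pt 1) φ.boundaryExtension e R) ∧
      vMid (D.pt 0) (D.pt 1) φ.boundaryExtension e R ∈ Icc (lastA (D.pt 0) R) (firstB (D.pt 1) R) ∧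
      attZ (D.pt 1) φ.boundaryExtension e R (vMid (D.pt 0) (D.pt 1) φ.boundaryExtension e R) =
        φ.boundaryExtension ((rEx (D.pt 0) (D.pt 1) φ.boundaryExtension e R : ℂ) *
          qEx (D.pt 1) φ.boundaryExtension e R) := by
  obtain ⟨hqim, hq0, -, hΦq⟩ := qEx_spec hφ he0 he1 hR hPcl hP1 hjb
  set q := qEx (D.pt 1) φ.boundaryExtension e R with hq
  set M := midSet (D.pt 0) (D.pt 1) φ.boundaryExtension e R with hM
  have hMc : IsClosed M := (isCompact_midSet hφ he0 he1 hR hPcl).isClosed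
  have hbM : D.pt 1 ∉ M := fun h =>
    hjb ((pt_one_mem_midSet_iff hφ he0 he1 hR hPcl hij).1 h)
  -- the ray `r ↦ Φ (r q)`
  have hg : ContinuousOn (fun r : ℝ => φ.boundaryExtension ((r : ℂ) * q)) (Ici (1 : ℝ)) :=
    (ray_continuousOn (continuousOn_boundaryExtension_im_nonneg φ) hqim).mono
      (Ici_subset_Ici.2 zero_le_one)
  have hg1 : φ.boundaryExtension (((1 : ℝ) : ℂ) * q) ∈ M := by
    rw [Complex.ofReal_one, one_mul, hΦq]
    exact ⟨_, right_mem_Icc.2 hij, rfl⟩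
  have hfar : ∃ Rb : ℝ, ∀ r, Rb ≤ r → φ.boundaryExtension ((r : ℂ) * q) ∉ M := by
    have ht := ray_tendsto_pt hφ.tendsto_boundaryExtension_cocompact hqim hq0
    have hev : ∀ᶠ r : ℝ in atTop, φ.boundaryExtension ((r : ℂ) * q) ∈ Mᶜ :=
      ht (hMc.isOpen_compl.mem_nhds hbM)
    obtain ⟨Rb, hRb⟩ := Filter.eventually_atTop.1 hev
    exact ⟨Rb, hRb⟩
  obtain ⟨Rb, hRb⟩ := hfar
  have hrEx : rEx (D.pt 0) (D.pt 1) φ.boundaryExtension e R =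
      sSup ({(1 : ℝ)} ∪ {r | 1 ≤ r ∧ φ.boundaryExtension ((r : ℂ) * q) ∈ M}) := by
    rw [rEx]
    congr 2
    ext r
    simp only [mem_setOf_eq, ne_eq, hjb, not_false_eq_true, true_and]
    rfl
  obtain ⟨hr1, hrin, hrout⟩ := lastExit_spec hg hMc hg1 hRb hrEx
  -- the last hit of `Jb`
  have hvMid : vMid (D.pt 0) (D.pt 1) φ.boundaryExtension e R =
      sSup {u | u ∈ Icc (lastA (D.pt 0) R) (firstB (D.pt 1) R) ∧
        attZ (D.pt 1) φ.boundaryExtension e R u =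
          φ.boundaryExtension ((rEx (D.pt 0) (D.pt 1) φ.boundaryExtension e R : ℂ) * q)} := by
    rw [vMid]
    congr 1
    ext u
    simp only [mem_union, mem_setOf_eq, ne_eq, hjb, not_false_eq_true, false_and, and_false,
      false_or, true_and]
    rfl
  obtain ⟨u, hu, hZu⟩ := hrin
  have h := lastHit_spec ((attZ_continuous hφ he0 he1 hR hPcl).continuousOn) ⟨u, hu, hZu⟩ hvMid
  exact ⟨hr1, ⟨u, hu, hZu⟩, hrout, h.1, h.2.1⟩

end Pushed

end AttachNoReturn

end Summit.CriticalPhenomena.SAWScalingLimit.Theorems
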